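import Summits.AtomisticToContinuum.Crystallization.Theorems.ChargedEnergyGapKinkCertB3
import Summits.AtomisticToContinuum.Crystallization.Theorems.ChargedEnergyGapKinkCertAA
import HarnessLib

/-!
# Charged energy gap — KINK CERTIFICATES, file B part 4/4: §S9 hole data → checker hypotheses, the OUTER and MIDDLE case lemmas · §S10 the four line excesses

student team «lens-3» (decomposition, residual mode), generation 84, NODE 85 «KinkCert»; namespace `…Theorems.ChargedEnergyGapChartDial`.
Continuation of `…ChargedEnergyGapKinkCertB` (see its module docstring for the design of the reflected checker `kcCheck` and the plan of the
soundness proof §S1–§S10); this part is the verbatim continuation of the single development, cut at section boundaries for the 400-line cap.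
Imports ONLY the previous part, the tree's `…ChargedEnergyGapKinkCertAA` (for the line-excess cells `kc_lineE1_4/5/6`) and `HarnessLib`;
no `set_option`, no `sorry`, no instance, no notation, no `private`, no `native_decide`.
-/

namespace Summit.AtomisticToContinuum.Crystallization.Theorems.ChargedEnergyGapChartDial

/-! ## §S9 From hole data to the checker's hypotheses (kink to the column floor); the two case lemmas -/

/-- ★ R1 (kink to the column floor): a hole of kink column `c` yields hole data of kink EXACTLY `(c+8)/10`, with the kink parts shrunk
proportionally and both turn costs not larger — every hypothesis of (Σ₃) is antitone in the turn costs and the goal reads the column only. -/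
theorem kc_hyp_of_holeData {ρ e m a b k : ℝ} (h : IsHoleData ρ e m a b k) {c : ℕ} (hc : capKCol k = c) :
    ∃ a' b', KcHyp (c + 8) ρ e m a' b' ∧ a' * (2 * e - a') ≤ a * (2 * e - a) ∧ b' * (2 * e - b') ≤ b * (2 * e - b) := by
  obtain ⟨ha0, haρ, hb0, hbρ, hab, hm1, hm2, hm3, hrow, hcol, hm140⟩ := h
  have hc2 : 2 ≤ c := hc ▸ hcol
  have hc12 : c ≤ 12 := hc ▸ kb_capKCol_le k
  have hk0 : 1 + ((c : ℝ) - 2) / 10 ≤ k := kb_le_of_capKCol k c hc2 hc12 (hc ▸ le_rfl)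
  have hm0 := fc_le_of_capKRow m hrow
  have hc2' : (2 : ℝ) ≤ c := by exact_mod_cast hc2
  have hk₀ : ((c + 8 : ℕ) : ℝ) / 10 = 1 + ((c : ℝ) - 2) / 10 := by push_cast; ring
  have hkpos : 0 < k := by linarith
  set L : ℝ := ((c + 8 : ℕ) : ℝ) / 10 / k with hL
  have hL0 : 0 ≤ L := div_nonneg (by rw [hk₀]; linarith) hkpos.le
  have hL1 : L ≤ 1 := (div_le_one hkpos).2 (by rw [hk₀]; exact hk0)
  have haL : L * a ≤ a := by nlinarith
  have hbL : L * b ≤ b := by nlinarith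
  have hae : a ≤ e := by linarith
  have hbe : b ≤ e := by linarith
  refine ⟨L * a, L * b, ⟨mul_nonneg hL0 ha0, le_trans haL haρ, mul_nonneg hL0 hb0, le_trans hbL hbρ, ?_, hm1,
    by linarith, by linarith, hm0, hm140⟩, kc_mono_sq (mul_nonneg hL0 ha0) haL hae le_rfl,
    kc_mono_sq (mul_nonneg hL0 hb0) hbL hbe le_rfl⟩
  rw [← mul_add, hab, hL]
  field_simp

/-- `kc_band` (docstring added by the landing lane; see the module docstring). [formal bookkeeping] -/
theorem kc_band {ρ : ℝ} (h1 : 679 / 1000 ≤ ρ) (h2 : ρ ≤ 691 / 1000) : (kcRLO : ℝ) ≤ ρ * kcD ∧ ρ * kcD ≤ kcRHI := by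
  have e1 : (kcRLO : ℝ) = 679 / 1000 * kcD := by norm_num [kcRLO, kcD]
  have e2 : (kcRHI : ℝ) = 691 / 1000 * kcD := by norm_num [kcRHI, kcD]
  rw [e1, e2]
  exact ⟨mul_le_mul_of_nonneg_right h1 kcD_pos.le, mul_le_mul_of_nonneg_right h2 kcD_pos.le⟩

/-- `kc_capK_eq_tabR` (docstring added by the landing lane; see the module docstring). [formal bookkeeping] -/
theorem kc_capK_eq_tabR {m : ℝ} (k : ℝ) (hm : m < 140) : capK m k = kcTabR (capKRow m) (capKCol k) := by
  unfold capK kcTabR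
  rw [if_neg (not_le.2 hm)]

/-- the admissible configuration of the reduced holes. -/
theorem kc_adm_of_holes {t₁ t₂ t₃ : ℕ} (cs : KcCase) (ht : cs.t₁ = t₁ ∧ cs.t₂ = t₂ ∧ cs.t₃ = t₃) {ρ : ℝ} {n₁ n₂ : ℕ}
    {e₁ m₁ a₁ a₁' b₁' e₂ m₂ a₂ b₂ a₂' b₂' e₃ m₃ b₃ a₃' b₃' : ℝ}
    (hy1 : KcHyp t₁ ρ e₁ m₁ a₁' b₁') (hy2 : KcHyp t₂ ρ e₂ m₂ a₂' b₂') (hy3 : KcHyp t₃ ρ e₃ m₃ a₃' b₃')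
    (hA1 : a₁' * (2 * e₁ - a₁') ≤ a₁ * (2 * e₁ - a₁)) (hB2 : b₂' * (2 * e₂ - b₂') ≤ b₂ * (2 * e₂ - b₂))
    (hA2 : a₂' * (2 * e₂ - a₂') ≤ a₂ * (2 * e₂ - a₂)) (hB3 : b₃' * (2 * e₃ - b₃') ≤ b₃ * (2 * e₃ - b₃))
    (hev1 : Even n₁) (hev2 : Even n₂) (hn1 : 1 ≤ n₁) (hn2 : 1 ≤ n₂) (hwin : ρ * ((n₁ : ℝ) + n₂) ≤ 160 + 2 * ρ)
    (hleg1 : a₁ * (2 * e₁ - a₁) + b₂ * (2 * e₂ - b₂) ≤ 2 * ρ ^ 2 * ((n₁ : ℝ) - 1))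
    (hleg2 : a₂ * (2 * e₂ - a₂) + b₃ * (2 * e₃ - b₃) ≤ 2 * ρ ^ 2 * ((n₂ : ℝ) - 1))
    (hp1 : e₂ ^ 2 ≤ e₁ ^ 2 - (n₁ : ℝ) * (a₁ * (2 * e₁ - a₁)) + ρ ^ 2 * n₁ * ((n₁ : ℝ) - 1))
    (hp2 : e₁ ^ 2 ≤ e₂ ^ 2 - (n₁ : ℝ) * (b₂ * (2 * e₂ - b₂)) + ρ ^ 2 * n₁ * ((n₁ : ℝ) - 1))
    (hp3 : e₃ ^ 2 ≤ e₂ ^ 2 - (n₂ : ℝ) * (a₂ * (2 * e₂ - a₂)) + ρ ^ 2 * n₂ * ((n₂ : ℝ) - 1))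
    (hp4 : e₂ ^ 2 ≤ e₃ ^ 2 - (n₂ : ℝ) * (b₃ * (2 * e₃ - b₃)) + ρ ^ 2 * n₂ * ((n₂ : ℝ) - 1)) :
    (⟨ρ, n₁, n₂, e₁, m₁, a₁', b₁', e₂, m₂, a₂', b₂', e₃, m₃, a₃', b₃'⟩ : KcConf).Adm cs := by
  obtain ⟨h1, h2, h3⟩ := ht
  have hn1' : (0 : ℝ) ≤ n₁ := Nat.cast_nonneg _
  have hn2' : (0 : ℝ) ≤ n₂ := Nat.cast_nonneg _
  have m1 := mul_le_mul_of_nonneg_left hA1 hn1'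
  have m2 := mul_le_mul_of_nonneg_left hB2 hn1'
  have m3 := mul_le_mul_of_nonneg_left hA2 hn2'
  have m4 := mul_le_mul_of_nonneg_left hB3 hn2'
  unfold KcConf.Adm
  rw [h1, h2, h3]
  exact ⟨hy1, hy2, hy3, hev1, hev2, hn1, hn2, hwin, by linarith only [hA1, hB2, hleg1], by linarith only [hA2, hB3, hleg2],
    by linarith only [m1, hp1], by linarith only [m2, hp2], by linarith only [m3, hp3], by linarith only [m4, hp4]⟩

/-- ★★ OUTER CASE LEMMA: a root certificate of case `(1, j, (j, c₂, c₃))` proves clause 1 of `ThreeHoleGoal` for three holes in exactly these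
kink columns, on the designated band. -/
theorem kc_outer_of_cert {j c₂ c₃ E10 : ℕ} {T : KcT}
    (hcert : kcCheck ⟨j, c₂, c₃, j + 8, c₂ + 8, c₃ + 8, 1, E10⟩ T (kcRoot ⟨j, c₂, c₃, j + 8, c₂ + 8, c₃ + 8, 1, E10⟩ kcRLO kcRHI) = true)
    (hE : lineExcess j 3 = (E10 : ℝ) / 10) {ρ : ℝ} (h1 : 679 / 1000 ≤ ρ) (h2 : ρ ≤ 691 / 1000) {n₁ n₂ : ℕ}
    {e₁ m₁ a₁ b₁ k₁ e₂ m₂ a₂ b₂ k₂ e₃ m₃ a₃ b₃ k₃ : ℝ} (hev1 : Even n₁) (hev2 : Even n₂) (hn1 : 1 ≤ n₁) (hn2 : 1 ≤ n₂)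
    (hwin : ρ * ((n₁ : ℝ) + n₂) ≤ 160 + 2 * ρ) (H1 : IsHoleData ρ e₁ m₁ a₁ b₁ k₁) (H2 : IsHoleData ρ e₂ m₂ a₂ b₂ k₂)
    (H3 : IsHoleData ρ e₃ m₃ a₃ b₃ k₃)
    (hleg1 : a₁ * (2 * e₁ - a₁) + b₂ * (2 * e₂ - b₂) ≤ 2 * ρ ^ 2 * ((n₁ : ℝ) - 1))
    (hleg2 : a₂ * (2 * e₂ - a₂) + b₃ * (2 * e₃ - b₃) ≤ 2 * ρ ^ 2 * ((n₂ : ℝ) - 1))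
    (hp1 : e₂ ^ 2 ≤ e₁ ^ 2 - (n₁ : ℝ) * (a₁ * (2 * e₁ - a₁)) + ρ ^ 2 * n₁ * ((n₁ : ℝ) - 1))
    (hp2 : e₁ ^ 2 ≤ e₂ ^ 2 - (n₁ : ℝ) * (b₂ * (2 * e₂ - b₂)) + ρ ^ 2 * n₁ * ((n₁ : ℝ) - 1))
    (hp3 : e₃ ^ 2 ≤ e₂ ^ 2 - (n₂ : ℝ) * (a₂ * (2 * e₂ - a₂)) + ρ ^ 2 * n₂ * ((n₂ : ℝ) - 1))
    (hp4 : e₂ ^ 2 ≤ e₃ ^ 2 - (n₂ : ℝ) * (b₃ * (2 * e₃ - b₃)) + ρ ^ 2 * n₂ * ((n₂ : ℝ) - 1))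
    (hj : capKCol k₁ = j) (hc2 : capKCol k₂ = c₂) (hc3 : capKCol k₃ = c₃) :
    capK m₂ k₂ + capK m₃ k₃ ≤ lineExcess j 3 := by
  obtain ⟨a₁', b₁', hy1, hA1, hB1⟩ := kc_hyp_of_holeData H1 hj
  obtain ⟨a₂', b₂', hy2, hA2, hB2⟩ := kc_hyp_of_holeData H2 hc2
  obtain ⟨a₃', b₃', hy3, hA3, hB3⟩ := kc_hyp_of_holeData H3 hc3
  have hj2 : 2 ≤ j := hj ▸ H1.2.2.2.2.2.2.2.2.2.1
  have hc22 : 2 ≤ c₂ := hc2 ▸ H2.2.2.2.2.2.2.2.2.2.1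
  have hc32 : 2 ≤ c₃ := hc3 ▸ H3.2.2.2.2.2.2.2.2.2.1
  have hj12 : j ≤ 12 := hj ▸ kb_capKCol_le k₁
  have hc212 : c₂ ≤ 12 := hc2 ▸ kb_capKCol_le k₂
  have hc312 : c₃ ≤ 12 := hc3 ▸ kb_capKCol_le k₃
  have hv : KcCase.Valid ⟨j, c₂, c₃, j + 8, c₂ + 8, c₃ + 8, 1, E10⟩ := by
    show 10 ≤ j + 8 ∧ 10 ≤ c₂ + 8 ∧ 10 ≤ c₃ + 8 ∧ j ≤ 12 ∧ c₂ ≤ 12 ∧ c₃ ≤ 12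
    exact ⟨by omega, by omega, by omega, hj12, hc212, hc312⟩
  have hq := kc_adm_of_holes ⟨j, c₂, c₃, j + 8, c₂ + 8, c₃ + 8, 1, E10⟩ ⟨rfl, rfl, rfl⟩ hy1 hy2 hy3 hA1 hB2 hA2 hB3 hev1 hev2 hn1
    hn2 hwin hleg1 hleg2 hp1 hp2 hp3 hp4
  have hg := kc_case_sound hv hcert _ hq (kc_band h1 h2)
  unfold KcGoal at hg
  dsimp only at hg
  rw [if_pos rfl] at hg
  rw [kc_capK_eq_tabR k₂ H2.2.2.2.2.2.2.2.2.2.2, kc_capK_eq_tabR k₃ H3.2.2.2.2.2.2.2.2.2.2, hc2, hc3, hE]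
  exact hg

/-- ★★ MIDDLE CASE LEMMA: a root certificate of case `(2, 3, (c₁, 3, c₃))` proves clause 2 of `ThreeHoleGoal` for three holes in exactly
these kink columns (key = hole 2 in column 3), on the designated band. -/
theorem kc_mid_of_cert {c₁ c₃ : ℕ} {T : KcT}
    (hcert : kcCheck ⟨c₁, 3, c₃, c₁ + 8, 11, c₃ + 8, 2, 180⟩ T (kcRoot ⟨c₁, 3, c₃, c₁ + 8, 11, c₃ + 8, 2, 180⟩ kcRLO kcRHI) = true)
    (hE : lineExcess 3 3 = ((180 : ℕ) : ℝ) / 10) {ρ : ℝ} (h1 : 679 / 1000 ≤ ρ) (h2 : ρ ≤ 691 / 1000) {n₁ n₂ : ℕ}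
    {e₁ m₁ a₁ b₁ k₁ e₂ m₂ a₂ b₂ k₂ e₃ m₃ a₃ b₃ k₃ : ℝ} (hev1 : Even n₁) (hev2 : Even n₂) (hn1 : 1 ≤ n₁) (hn2 : 1 ≤ n₂)
    (hwin : ρ * ((n₁ : ℝ) + n₂) ≤ 160 + 2 * ρ) (H1 : IsHoleData ρ e₁ m₁ a₁ b₁ k₁) (H2 : IsHoleData ρ e₂ m₂ a₂ b₂ k₂)
    (H3 : IsHoleData ρ e₃ m₃ a₃ b₃ k₃)
    (hleg1 : a₁ * (2 * e₁ - a₁) + b₂ * (2 * e₂ - b₂) ≤ 2 * ρ ^ 2 * ((n₁ : ℝ) - 1))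
    (hleg2 : a₂ * (2 * e₂ - a₂) + b₃ * (2 * e₃ - b₃) ≤ 2 * ρ ^ 2 * ((n₂ : ℝ) - 1))
    (hp1 : e₂ ^ 2 ≤ e₁ ^ 2 - (n₁ : ℝ) * (a₁ * (2 * e₁ - a₁)) + ρ ^ 2 * n₁ * ((n₁ : ℝ) - 1))
    (hp2 : e₁ ^ 2 ≤ e₂ ^ 2 - (n₁ : ℝ) * (b₂ * (2 * e₂ - b₂)) + ρ ^ 2 * n₁ * ((n₁ : ℝ) - 1))
    (hp3 : e₃ ^ 2 ≤ e₂ ^ 2 - (n₂ : ℝ) * (a₂ * (2 * e₂ - a₂)) + ρ ^ 2 * n₂ * ((n₂ : ℝ) - 1))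
    (hp4 : e₂ ^ 2 ≤ e₃ ^ 2 - (n₂ : ℝ) * (b₃ * (2 * e₃ - b₃)) + ρ ^ 2 * n₂ * ((n₂ : ℝ) - 1))
    (hc1 : capKCol k₁ = c₁) (hj : capKCol k₂ = 3) (hc3 : capKCol k₃ = c₃) :
    capK m₁ k₁ + capK m₃ k₃ ≤ lineExcess 3 3 := by
  obtain ⟨a₁', b₁', hy1, hA1, hB1⟩ := kc_hyp_of_holeData H1 hc1
  obtain ⟨a₂', b₂', hy2, hA2, hB2⟩ := kc_hyp_of_holeData H2 hj
  obtain ⟨a₃', b₃', hy3, hA3, hB3⟩ := kc_hyp_of_holeData H3 hc3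
  have hc12 : 2 ≤ c₁ := hc1 ▸ H1.2.2.2.2.2.2.2.2.2.1
  have hc32 : 2 ≤ c₃ := hc3 ▸ H3.2.2.2.2.2.2.2.2.2.1
  have hc112 : c₁ ≤ 12 := hc1 ▸ kb_capKCol_le k₁
  have hc312 : c₃ ≤ 12 := hc3 ▸ kb_capKCol_le k₃
  have hv : KcCase.Valid ⟨c₁, 3, c₃, c₁ + 8, 11, c₃ + 8, 2, 180⟩ := by
    show 10 ≤ c₁ + 8 ∧ 10 ≤ 11 ∧ 10 ≤ c₃ + 8 ∧ c₁ ≤ 12 ∧ 3 ≤ 12 ∧ c₃ ≤ 12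
    exact ⟨by omega, by omega, by omega, hc112, by omega, hc312⟩
  have hq := kc_adm_of_holes ⟨c₁, 3, c₃, c₁ + 8, 11, c₃ + 8, 2, 180⟩ ⟨rfl, rfl, rfl⟩ hy1 hy2 hy3 hA1 hB2 hA2 hB3 hev1 hev2 hn1
    hn2 hwin hleg1 hleg2 hp1 hp2 hp3 hp4
  have hg := kc_case_sound hv hcert _ hq (kc_band h1 h2)
  unfold KcGoal at hg
  dsimp only at hg
  rw [if_neg (by decide)] at hg
  rw [kc_capK_eq_tabR k₁ H1.2.2.2.2.2.2.2.2.2.2, kc_capK_eq_tabR k₃ H3.2.2.2.2.2.2.2.2.2.2, hc1, hc3, hE]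
  exact hg

/-! ## §S10 The four line excesses `E(j, 3)`, `j = 3 … 6` (cells `j = 4, 5, 6` are `kc_lineE1_j` of file AA) -/

/-- `kc_lineRow1_3` (docstring added by the landing lane; see the module docstring). [formal bookkeeping] -/
theorem kc_lineRow1_3 : (lineExcessRows.getD 1 []).getD 3 0 = 18 := by
  decide +kernel

/-- `kc_lineExcess_3_3` (docstring added by the landing lane; see the module docstring). [formal bookkeeping] -/
theorem kc_lineExcess_3_3 : lineExcess 3 3 = ((180 : ℕ) : ℝ) / 10 := by
  unfold lineExcess
  rw [if_neg (by omega), if_neg (by omega), kc_lineRow1_3]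
  push_cast
  rw [max_eq_right (by norm_num)]; norm_num

/-- `kc_lineExcess_4_3` (docstring added by the landing lane; see the module docstring). [formal bookkeeping] -/
theorem kc_lineExcess_4_3 : lineExcess 4 3 = ((167 : ℕ) : ℝ) / 10 := by
  unfold lineExcess
  rw [if_neg (by omega), if_neg (by omega), kc_lineE1_4]
  push_cast
  rw [max_eq_right (by norm_num)]

/-- `kc_lineExcess_5_3` (docstring added by the landing lane; see the module docstring). [formal bookkeeping] -/
theorem kc_lineExcess_5_3 : lineExcess 5 3 = ((187 : ℕ) : ℝ) / 10 := by
  unfold lineExcess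
  rw [if_neg (by omega), if_neg (by omega), kc_lineE1_5]
  push_cast
  rw [max_eq_right (by norm_num)]

/-- `kc_lineExcess_6_3` (docstring added by the landing lane; see the module docstring). [formal bookkeeping] -/
theorem kc_lineExcess_6_3 : lineExcess 6 3 = ((232 : ℕ) : ℝ) / 10 := by
  unfold lineExcess
  rw [if_neg (by omega), if_neg (by omega), kc_lineE1_6]
  push_cast
  rw [max_eq_right (by norm_num)]; norm_num

end Summit.AtomisticToContinuum.Crystallization.Theorems.ChargedEnergyGapChartDial
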